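import Summits.QuantumFields.YangMills.Theorems.UnitScaleTiltProp7DivRecoveryForm
import HarnessLib

/-!
# Route `UnitScaleTilt`, crux K1 «MinimiserStabilityRegPr» (stmt-QuantumFields-19200) — route-R E′ (A′), (N06) coercivity row `hCo` of ✓`Prop7NormG0OfCoercive.hN06_of_coerciveRow`,
# LANE II «DIVERGENCE RECOVERY AT CURVED W» (★★OWNER g29 WORD 2026-08-29T05:46Z «… then the DOOR `hCo_of_divRecovery`»; LOCATE #60 (V3)):
# **THE DOOR — `hCo` ⟸ {curved full-Landau engine in `L²` letters} ∧ {DIVERGENCE RECOVERY}**, the almost-positivity of `Δ^η` and the form of `Δ_aᶜ` being theorems (✓`almostPos_DeltaEtaSlot_of_regPr`, ✓`re_inner_laplaceAK_comb_DeltaEta_eq`)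

Cell `ym3-torus`, width seat `ym3-torus-px4` (gen 7).  THEOREMS ONLY (0 `def`, 0 `sorry`); `--supports stmt-QuantumFields-19200 --as helper`, count-neutral; a DOOR, not a flip ask.
YM₃ on T³ is a ladder rung (R3), not d = 4, not infinite volume, not the Clay problem; nothing here claims [Balaban1985BackgroundPropagators] Thm 3.3 ∕ 3.11, `hCo`, `hN06`, `hcoS`, E′, EX, H,
the crux or the gap — BOTH displayed rows below are HYPOTHESES (the engine row is the tree's ✓`Prop7CovariantOffKernel.sum_normSq_le_curl_sq_add_divB_sq_add_avg_T3` modulo the `L²` letter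
rows (B4)(B4′) of LOCATE #60; the divergence-recovery row is OPEN — LANE II, banked, not staffed).

THE PRINT.  [Balaban1985BackgroundPropagators] Thm 3.11 p.416 «`Δ_a` is positive definite» for `Δ_a(U) = Δ^η(U) + D R(U) D* + Q*(U) a Q(U)` ((3.26) p.395), `R(U)` the orthogonal projection onto
`Δ^η_U N(Q′)` ((3.21) p.394); (3.10) p.392 `Δ^η = D*D + Δ′`, «`Δ′` will be a bounded, small operator».

WHY ∕ WHAT (LOCATE #60 §0 (V1)–(V3), HOME `ym3-torus-px4/g7/LOCATE-RCORE-GAMMA-px4g7.md`).  By ✓`Prop7DivRecoveryForm.re_inner_laplaceAK_comb_DeltaEta_eq` the displayed coercivity row reads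
`T(y) := re⟪y,Δ^η_W y⟫ + ‖R_W D*_W y‖² + aQ‖Q_W y‖² ≥ γ‖y‖²`; the tree's curved K-∕volume-uniform full-Landau engine bounds the same form WITH `‖D*_W y‖²` IN PLACE OF `‖R_W D*_W y‖²`; so
`hCo` follows from two displayed rows — (ENG) the engine in the route's `L²` letters and (REC) «divergence recovery»: for every `δ > 0`, below an L-only radius,
`‖D*_W y‖² ≤ C·(‖R_W D*_W y‖² + aQ‖Q_W y‖² + re⟪y,Δ^η_W y⟫) + (C′·e + δ)·‖y‖²` — by elementary real arithmetic, with ✓`almostPos_DeltaEtaSlot_of_regPr` (`re⟪y,Δ^η_W y⟫ ≥ −1029e‖y‖²` on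
`RegPr(e)`) controlling the sign of the Hessian term.  Constants: all `∃` after `∀ L` (c2), members `∀ F hF n K hnK e W` inside; penalty `aQ := a₀(c₀∕cB)ℓ³` as in ✓p699006; `a₀ > 0`.

WHAT IS PROVED (ns `…Theorems.Prop7HcoOfDivRecovery`): `coercive_of_engine_of_recovery` (generic real arithmetic: numbers `P Rr A D N ≥ …` ⊢ the coercivity inequality),
★★★`hCo_of_divRecovery` (the DOOR: (ENG) ∧ (REC) ⊢ the `hCo` hypothesis of ✓`hN06_of_coerciveRow` TOKEN FOR TOKEN), ★★★`hN06_of_divRecovery` (composed with ✓p699006: ⊢ `hN06`).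
HONEST SCOPE.  A door (real arithmetic + two tree rows by name); (ENG)-in-`L²`-letters and (REC) are displayed, OPEN; rung R3, not Clay; YM gap NOT proved.

References: T. Bałaban, CMP **99** (1985) 389–434 [Balaban1985BackgroundPropagators] ((3.10) p.392, (3.21) p.394, (3.26)–(3.27) p.395, Thm 3.3 p.399, Thm 3.11 p.416); CMP **95** (1984) 17–40
[Balaban1984PropagatorsI] ((1.21) p.21, Prop. 1.1 (1.90) p.33).
-/

set_option autoImplicit false

noncomputable section

open scoped InnerProductSpace ComplexConjugate Matrix.Norms.L2Operator BigOperators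

namespace Summit.QuantumFields.YangMills.Theorems.Prop7HcoOfDivRecovery

open Literature.MathematicalPhysics.QuantumFieldTheory.Balaban1983to89
open Literature.MathematicalPhysics.QuantumFieldTheory.Balaban1983to89.T3ContinuumYM3Torus
open Literature.MathematicalPhysics.QuantumFieldTheory.Balaban1983to89.T3PrintedRegularMinimiser (RegPr)
open B11Eq103H1Complex (SiteL2K BondL2K laplaceAK)
open Summit.QuantumFields.YangMills.Theorems.Prop7SectET3Transport (periodsT3)
open Summit.QuantumFields.YangMills.Theorems.Prop7SectET3HilbertLetters (W₂ DL2 DstarL2)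
open Summit.QuantumFields.YangMills.Theorems.Prop7SectET3WilsonHessian (DeltaEtaSlot)
open Summit.QuantumFields.YangMills.Theorems.Prop7SectET3CombLetters (Qkc)
open Summit.QuantumFields.YangMills.Theorems.Prop7QprimeCombL2 (RcombL2)
open Summit.QuantumFields.YangMills.Theorems.Prop7DeltaEtaAlmostPositive (almostPos_DeltaEtaSlot_of_regPr)
open Summit.QuantumFields.YangMills.Theorems.Prop7DivRecoveryForm (re_inner_laplaceAK_comb_DeltaEta_eq)
open Summit.QuantumFields.YangMills.Theorems.Prop7NormG0OfCoercive (hN06_of_coerciveRow)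

/-! ## §1 The real arithmetic -/

/-- **COERCIVITY FROM ENGINE + RECOVERY (real arithmetic)**: with `P` the Hessian term (`P ≥ −θ·N`), `Rr, A ≥ 0` the projected-divergence and penalty terms, `D` the full divergence term,
`N = ‖y‖²`: the engine `γE·N ≤ P + κD·D + κQ·A + θE·N`, the recovery `D ≤ C·(Rr + A + P) + s·N` and the windows `κD·s + θE + (2 + κD·C + κQ)·θ ≤ γE∕2` give
`(γE ∕ (2·(2 + κD·C + κQ)))·N ≤ P + Rr + A`. [cite: Balaban1985BackgroundPropagators, Thm 3.11 p.416] -/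
theorem coercive_of_engine_of_recovery {P Rr A D N θ γE κD κQ θE C s : ℝ}
    (hN : 0 ≤ N) (hRr : 0 ≤ Rr) (hA : 0 ≤ A) (hθ : 0 ≤ θ) (hκD : 0 ≤ κD) (hκQ : 0 ≤ κQ) (hC : 0 ≤ C)
    (hP : -(θ * N) ≤ P)
    (hEng : γE * N ≤ P + κD * D + κQ * A + θE * N)
    (hRec : D ≤ C * (Rr + A + P) + s * N)
    (hwin : κD * s + θE + (2 + κD * C + κQ) * θ ≤ γE / 2) :
    (γE / (2 * (2 + κD * C + κQ))) * N ≤ P + Rr + A := by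
  set CT : ℝ := 2 + κD * C + κQ with hCT
  have hCT1 : 1 ≤ CT := by rw [hCT]; nlinarith
  have hCT0 : 0 < CT := by linarith
  -- insert the recovery into the engine
  have h1 : γE * N ≤ (1 + κD * C) * P + κD * C * Rr + (κD * C + κQ) * A + (κD * s + θE) * N := by
    have := mul_le_mul_of_nonneg_left hRec hκD
    nlinarith
  -- bound each coefficient by `CT`, paying `θ·N` for the possibly negative `P`
  have h2 : (1 + κD * C) * P ≤ CT * P + (CT - (1 + κD * C)) * (θ * N) := by
    have hc : 0 ≤ CT - (1 + κD * C) := by rw [hCT]; nlinarith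
    nlinarith
  have h3 : κD * C * Rr ≤ CT * Rr := by
    have : κD * C ≤ CT := by rw [hCT]; nlinarith
    nlinarith
  have h4 : (κD * C + κQ) * A ≤ CT * A := by
    have : κD * C + κQ ≤ CT := by rw [hCT]; linarith
    nlinarith
  have hθN : 0 ≤ (1 + κD * C) * (θ * N) := by positivity
  have h5 : γE * N ≤ CT * (P + Rr + A) + (κD * s + θE + CT * θ) * N := by nlinarith [h1, h2, h3, h4, hθN]
  have h6 : (γE / 2) * N ≤ CT * (P + Rr + A) := by
    have : (κD * s + θE + CT * θ) * N ≤ (γE / 2) * N := mul_le_mul_of_nonneg_right (by rw [hCT]; linarith) hN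
    linarith
  rw [show γE / (2 * CT) * N = ((γE / 2) * N) / CT by field_simp]
  rw [div_le_iff₀ hCT0]
  linarith

/-! ## §2 The door at the comb slots of record -/

section Door

variable (c₀ cB a₀ : ℕ → ℝ) [hc₀ : ∀ L : ℕ, Fact (0 < c₀ L)] [hcB : ∀ L : ℕ, Fact (0 < cB L)]

/-- ★★★ **THE DOOR `hCo_of_divRecovery`** — the (N06) coercivity row `hCo` of ✓`hN06_of_coerciveRow` (print's Thm 3.11 read quantitatively at the comb slots `(DeltaEtaSlot, RcombL2, Qkc)`,
penalty `aQ = a₀(c₀∕cB)ℓ³`) FROM two displayed rows: (ENG) the curved full-Landau engine in the route's `L²` letters (L-only `γE κD κQ θE`, radius `eE`) and (REC) «DIVERGENCE RECOVERY»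
(for every `δ > 0`: L-only `C C′`, radius `eR`).  Inside, by name: ✓`almostPos_DeltaEtaSlot_of_regPr` (`θ = 1029e`) and ✓`re_inner_laplaceAK_comb_DeltaEta_eq`.  LOCATE #60 (V3).
[cite: Balaban1985BackgroundPropagators, Thm 3.11 p.416, (3.26) p.395, (3.10) p.392, (3.21) p.394; Balaban1984PropagatorsI, (1.21) p.21, Prop. 1.1 p.33] -/
theorem hCo_of_divRecovery (ha₀ : ∀ L, 1 < L → 0 < a₀ L)
    (hEng : ∀ (L : ℕ), 1 < L → ∃ γE κD κQ θE eE : ℝ, 0 < γE ∧ 0 ≤ κD ∧ 0 ≤ κQ ∧ 0 ≤ θE ∧ 0 < eE ∧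
      ∀ (F : T3Family), F.L = L → ∀ (n K : ℕ) (hnK : n < K) (e : ℝ) (W : GaugeField (F.P K) 0 (Matrix.specialUnitaryGroup (Fin 2) ℂ)),
        0 < e → e ≤ eE → RegPr F n K e W →
        ∀ y : BondL2K ℂ 3 (periodsT3 F K) (c₀ F.L) W₂,
          γE * ‖y‖ ^ 2 ≤ RCLike.re ⟪y, DeltaEtaSlot F n K (c₀ F.L) W y⟫_ℂ + κD * ‖DstarL2 F n K (c₀ F.L) W y‖ ^ 2
            + κQ * ((a₀ F.L * (c₀ F.L / cB F.L) * ((F.L : ℝ) ^ (K - n)) ^ 3) * ‖Qkc F n K hnK.le (c₀ F.L) (cB F.L) W y‖ ^ 2) + θE * e * ‖y‖ ^ 2)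
    (hRec : ∀ (L : ℕ), 1 < L → ∀ δ : ℝ, 0 < δ → ∃ C C' eR : ℝ, 0 ≤ C ∧ 0 ≤ C' ∧ 0 < eR ∧
      ∀ (F : T3Family), F.L = L → ∀ (n K : ℕ) (hnK : n < K) (e : ℝ) (W : GaugeField (F.P K) 0 (Matrix.specialUnitaryGroup (Fin 2) ℂ)),
        0 < e → e ≤ eR → RegPr F n K e W →
        ∀ y : BondL2K ℂ 3 (periodsT3 F K) (c₀ F.L) W₂,
          ‖DstarL2 F n K (c₀ F.L) W y‖ ^ 2
            ≤ C * (‖RcombL2 F n K (c₀ F.L) W (DstarL2 F n K (c₀ F.L) W y)‖ ^ 2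
                  + (a₀ F.L * (c₀ F.L / cB F.L) * ((F.L : ℝ) ^ (K - n)) ^ 3) * ‖Qkc F n K hnK.le (c₀ F.L) (cB F.L) W y‖ ^ 2
                  + RCLike.re ⟪y, DeltaEtaSlot F n K (c₀ F.L) W y⟫_ℂ)
              + (C' * e + δ) * ‖y‖ ^ 2) :
    ∀ (L : ℕ), 1 < L → ∃ γ eN : ℝ, 0 < γ ∧ 0 < eN ∧
      ∀ (F : T3Family), F.L = L → ∀ (n K : ℕ) (hnK : n < K) (e : ℝ) (W : GaugeField (F.P K) 0 (Matrix.specialUnitaryGroup (Fin 2) ℂ)),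
        0 < e → e ≤ eN → RegPr F n K e W →
        ∀ y : BondL2K ℂ 3 (periodsT3 F K) (c₀ F.L) W₂,
          γ * ‖y‖ ^ 2 ≤ RCLike.re ⟪y, laplaceAK (DeltaEtaSlot F n K (c₀ F.L) W) (DL2 F n K (c₀ F.L) W) (RcombL2 F n K (c₀ F.L) W) (DstarL2 F n K (c₀ F.L) W)
              (Qkc F n K hnK.le (c₀ F.L) (cB F.L) W) (LinearMap.adjoint (Qkc F n K hnK.le (c₀ F.L) (cB F.L) W))
              (((a₀ F.L * (c₀ F.L / cB F.L) * ((F.L : ℝ) ^ (K - n)) ^ 3 : ℝ) : ℂ)) y⟫_ℂ := by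
  intro L hL
  obtain ⟨γE, κD, κQ, θE, eE, hγE, hκD, hκQ, hθE, heE, HE⟩ := hEng L hL
  -- the demand on the recovery slack
  set δ : ℝ := γE / (8 * (κD + 1)) with hδ
  have hδpos : 0 < δ := by rw [hδ]; positivity
  obtain ⟨C, C', eR, hC, hC', heR, HR⟩ := hRec L hL δ hδpos
  set CT : ℝ := 2 + κD * C + κQ with hCT
  -- the radius: the engine's, the recovery's, and the `e`-windows
  set eW : ℝ := γE / (8 * (κD * C' + θE + CT * 1029 + 1)) with heW
  have hden : 0 < κD * C' + θE + CT * 1029 + 1 := by rw [hCT]; positivity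
  have heWpos : 0 < eW := by rw [heW]; positivity
  refine ⟨γE / (2 * CT), min eE (min eR eW), by rw [hCT]; positivity, lt_min heE (lt_min heR heWpos), ?_⟩
  intro F hF n K hnK e W he heN hreg y
  have heE' : e ≤ eE := heN.trans (min_le_left _ _)
  have heR' : e ≤ eR := heN.trans ((min_le_right _ _).trans (min_le_left _ _))
  have heW' : e ≤ eW := heN.trans ((min_le_right _ _).trans (min_le_right _ _))
  -- the letters
  set aQ : ℝ := a₀ F.L * (c₀ F.L / cB F.L) * ((F.L : ℝ) ^ (K - n)) ^ 3 with haQ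
  have haQ0 : 0 ≤ aQ := by
    have h1 : 0 < a₀ F.L := by rw [hF]; exact ha₀ L hL
    have h2 : 0 < c₀ F.L := (hc₀ F.L).out
    have h3 : 0 < cB F.L := (hcB F.L).out
    have h4 : (0 : ℝ) < (F.L : ℝ) := by have := F.hL.2; exact_mod_cast (by omega : 0 < F.L)
    rw [haQ]; positivity
  rw [re_inner_laplaceAK_comb_DeltaEta_eq F n K (c₀ F.L) (cB F.L) hnK.le aQ W y]
  -- the rows at this member
  have hE := HE F hF n K hnK e W he heE' hreg y
  have hR' := HR F hF n K hnK e W he heR' hreg y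
  have hP := almostPos_DeltaEtaSlot_of_regPr (c₀ := c₀ F.L) he.le W hreg y
  -- real arithmetic
  have key := coercive_of_engine_of_recovery (P := RCLike.re ⟪y, DeltaEtaSlot F n K (c₀ F.L) W y⟫_ℂ)
    (Rr := ‖RcombL2 F n K (c₀ F.L) W (DstarL2 F n K (c₀ F.L) W y)‖ ^ 2) (A := aQ * ‖Qkc F n K hnK.le (c₀ F.L) (cB F.L) W y‖ ^ 2)
    (D := ‖DstarL2 F n K (c₀ F.L) W y‖ ^ 2) (N := ‖y‖ ^ 2) (θ := 1029 * e) (γE := γE) (κD := κD) (κQ := κQ) (θE := θE * e) (C := C) (s := C' * e + δ)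
    (sq_nonneg _) (sq_nonneg _) (mul_nonneg haQ0 (sq_nonneg _)) (by positivity) hκD hκQ hC
    (by linarith) (by linarith) (by linarith) ?_
  · simpa [hCT] using key
  -- the window `κD·(C′e + δ) + θE·e + CT·1029e ≤ γE∕2`
  have hw1 : κD * δ ≤ γE / 8 := by
    have h1 : κD * δ ≤ (κD + 1) * δ := by nlinarith [hδpos.le]
    have h2 : (κD + 1) * δ = γE / 8 := by
      rw [hδ]; field_simp
    linarith
  have hw2 : (κD * C' + θE + CT * 1029) * e ≤ γE / 8 := by
    have h1 : (κD * C' + θE + CT * 1029) * e ≤ (κD * C' + θE + CT * 1029 + 1) * eW :=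
      mul_le_mul (by linarith) heW' he.le hden.le
    have h2 : (κD * C' + θE + CT * 1029 + 1) * eW = γE / 8 := by rw [heW]; field_simp
    linarith
  nlinarith

/-- ★★★ **COMPOSED WITH ✓p699006**: (ENG) ∧ (REC) ⊢ the displayed `hN06` row of the junction of record (S27ᴸ–S29ᴸ ∕ E2E v3) TOKEN FOR TOKEN, `B₀ := γ⁻¹`.
[cite: Balaban1985BackgroundPropagators, Thm 3.11 p.416, Thm 3.3 p.399, (3.26)-(3.27) p.395; Balaban1985Variational, (141)-(142) p.299] -/
theorem hN06_of_divRecovery (ha₀ : ∀ L, 1 < L → 0 < a₀ L)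
    (hEng : ∀ (L : ℕ), 1 < L → ∃ γE κD κQ θE eE : ℝ, 0 < γE ∧ 0 ≤ κD ∧ 0 ≤ κQ ∧ 0 ≤ θE ∧ 0 < eE ∧
      ∀ (F : T3Family), F.L = L → ∀ (n K : ℕ) (hnK : n < K) (e : ℝ) (W : GaugeField (F.P K) 0 (Matrix.specialUnitaryGroup (Fin 2) ℂ)),
        0 < e → e ≤ eE → RegPr F n K e W →
        ∀ y : BondL2K ℂ 3 (periodsT3 F K) (c₀ F.L) W₂,
          γE * ‖y‖ ^ 2 ≤ RCLike.re ⟪y, DeltaEtaSlot F n K (c₀ F.L) W y⟫_ℂ + κD * ‖DstarL2 F n K (c₀ F.L) W y‖ ^ 2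
            + κQ * ((a₀ F.L * (c₀ F.L / cB F.L) * ((F.L : ℝ) ^ (K - n)) ^ 3) * ‖Qkc F n K hnK.le (c₀ F.L) (cB F.L) W y‖ ^ 2) + θE * e * ‖y‖ ^ 2)
    (hRec : ∀ (L : ℕ), 1 < L → ∀ δ : ℝ, 0 < δ → ∃ C C' eR : ℝ, 0 ≤ C ∧ 0 ≤ C' ∧ 0 < eR ∧
      ∀ (F : T3Family), F.L = L → ∀ (n K : ℕ) (hnK : n < K) (e : ℝ) (W : GaugeField (F.P K) 0 (Matrix.specialUnitaryGroup (Fin 2) ℂ)),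
        0 < e → e ≤ eR → RegPr F n K e W →
        ∀ y : BondL2K ℂ 3 (periodsT3 F K) (c₀ F.L) W₂,
          ‖DstarL2 F n K (c₀ F.L) W y‖ ^ 2
            ≤ C * (‖RcombL2 F n K (c₀ F.L) W (DstarL2 F n K (c₀ F.L) W y)‖ ^ 2
                  + (a₀ F.L * (c₀ F.L / cB F.L) * ((F.L : ℝ) ^ (K - n)) ^ 3) * ‖Qkc F n K hnK.le (c₀ F.L) (cB F.L) W y‖ ^ 2
                  + RCLike.re ⟪y, DeltaEtaSlot F n K (c₀ F.L) W y⟫_ℂ)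
              + (C' * e + δ) * ‖y‖ ^ 2) :
    ∀ (L : ℕ), 1 < L → ∃ B₀ eN : ℝ, 0 < B₀ ∧ 0 < eN ∧
      ∀ (F : T3Family), F.L = L → ∀ (n K : ℕ) (hnK : n < K) (e : ℝ) (W : GaugeField (F.P K) 0 (Matrix.specialUnitaryGroup (Fin 2) ℂ)),
        0 < e → e ≤ eN → RegPr F n K e W →
        ∃ G₀ : BondL2K ℂ 3 (periodsT3 F K) (c₀ F.L) W₂ →ₗ[ℂ] BondL2K ℂ 3 (periodsT3 F K) (c₀ F.L) W₂,
          laplaceAK (DeltaEtaSlot F n K (c₀ F.L) W) (DL2 F n K (c₀ F.L) W) (RcombL2 F n K (c₀ F.L) W) (DstarL2 F n K (c₀ F.L) W)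
              (Qkc F n K hnK.le (c₀ F.L) (cB F.L) W) (LinearMap.adjoint (Qkc F n K hnK.le (c₀ F.L) (cB F.L) W))
              (((a₀ F.L * (c₀ F.L / cB F.L) * ((F.L : ℝ) ^ (K - n)) ^ 3 : ℝ) : ℂ)) ∘ₗ G₀ = LinearMap.id ∧
          ∀ f, ‖G₀ f‖ ≤ B₀ * ‖f‖ :=
  hN06_of_coerciveRow c₀ cB a₀ (hCo_of_divRecovery c₀ cB a₀ ha₀ hEng hRec)

end Door

/-! ## §3 (v1.1, pure append) The door AT THE SKELETON'S TEXTS — ★p1 g19 `SKELETON-LANE2-DIVREC` v1.1 §1 `divRecovery_row` and §2 `engine_slotLetters` VERBATIM as hypotheses -/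

section Skeleton

variable (c₀ cB a₀ : ℕ → ℝ) [hc₀ : ∀ L : ℕ, Fact (0 < c₀ L)] [hcB : ∀ L : ℕ, Fact (0 < cB L)]

/-- ★★★ **THE SKELETON'S DOOR, DISCHARGED** (★p1 g19 `SKELETON-LANE2-DIVREC.v1.1` §2 `hCo_of_divRecovery`, there `sorry`): its two hypotheses — (V3) `divRecovery_row` (`Q`-resource
`ℓ³‖Qkc y‖²`, the Hessian term carried as `re⟪y,Δ^η y⟫ + 1029e‖y‖² ≥ 0`, slack `δ`) and (B4★) `engine_slotLetters` (`‖y‖² ≤ CE·((re⟪y,Δ^η y⟫ + 1029e‖y‖²) + ‖D*y‖²) + CQ·ℓ³‖Qkc y‖²`) —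
TOKEN FOR TOKEN ⊢ the `hCo` row of ✓`hN06_of_coerciveRow`, by the §2 door after the L-only re-lettering `ℓ³‖Q y‖² = (cB∕(a₀c₀))·aQ‖Q y‖²`, `CE ↦ max CE 1`, `C ↦ max C (C·cB∕(a₀c₀))` (the
possibly negative Hessian term is re-absorbed through ✓`almostPos_DeltaEtaSlot_of_regPr`).  [cite: Balaban1985BackgroundPropagators, Thm 3.11 p.416, (3.26) p.395, (3.10) p.392] -/
theorem hCo_of_divRecovery_skeleton (ha₀ : ∀ L : ℕ, 0 < a₀ L)
    (hDR : ∀ (L : ℕ), 1 < L → ∀ (δ : ℝ), 0 < δ → ∃ C eR : ℝ, 0 ≤ C ∧ 0 < eR ∧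
      ∀ (F : T3Family), F.L = L → ∀ (n K : ℕ) (hnK : n < K) (e : ℝ) (W : GaugeField (F.P K) 0 (Matrix.specialUnitaryGroup (Fin 2) ℂ)),
        0 < e → e ≤ eR → RegPr F n K e W →
        ∀ y : BondL2K ℂ 3 (periodsT3 F K) (c₀ F.L) W₂,
          ‖DstarL2 F n K (c₀ F.L) W y‖ ^ 2
            ≤ C * (‖RcombL2 F n K (c₀ F.L) W (DstarL2 F n K (c₀ F.L) W y)‖ ^ 2
                  + ((F.L : ℝ) ^ (K - n)) ^ 3 * ‖Qkc F n K hnK.le (c₀ F.L) (cB F.L) W y‖ ^ 2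
                  + (RCLike.re ⟪y, DeltaEtaSlot F n K (c₀ F.L) W y⟫_ℂ + 1029 * e * ‖y‖ ^ 2))
              + δ * ‖y‖ ^ 2)
    (hE : ∀ (L : ℕ), 1 < L → ∃ CE CQ eE : ℝ, 0 ≤ CE ∧ 0 ≤ CQ ∧ 0 < eE ∧
      ∀ (F : T3Family), F.L = L → ∀ (n K : ℕ) (hnK : n < K) (e : ℝ) (W : GaugeField (F.P K) 0 (Matrix.specialUnitaryGroup (Fin 2) ℂ)),
        0 < e → e ≤ eE → RegPr F n K e W →
        ∀ y : BondL2K ℂ 3 (periodsT3 F K) (c₀ F.L) W₂,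
          ‖y‖ ^ 2 ≤ CE * ((RCLike.re ⟪y, DeltaEtaSlot F n K (c₀ F.L) W y⟫_ℂ + 1029 * e * ‖y‖ ^ 2) + ‖DstarL2 F n K (c₀ F.L) W y‖ ^ 2)
                    + CQ * (((F.L : ℝ) ^ (K - n)) ^ 3 * ‖Qkc F n K hnK.le (c₀ F.L) (cB F.L) W y‖ ^ 2)) :
    ∀ (L : ℕ), 1 < L → ∃ γ eN : ℝ, 0 < γ ∧ 0 < eN ∧
      ∀ (F : T3Family), F.L = L → ∀ (n K : ℕ) (hnK : n < K) (e : ℝ) (W : GaugeField (F.P K) 0 (Matrix.specialUnitaryGroup (Fin 2) ℂ)),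
        0 < e → e ≤ eN → RegPr F n K e W →
        ∀ y : BondL2K ℂ 3 (periodsT3 F K) (c₀ F.L) W₂,
          γ * ‖y‖ ^ 2 ≤ RCLike.re ⟪y, laplaceAK (DeltaEtaSlot F n K (c₀ F.L) W) (DL2 F n K (c₀ F.L) W) (RcombL2 F n K (c₀ F.L) W) (DstarL2 F n K (c₀ F.L) W)
              (Qkc F n K hnK.le (c₀ F.L) (cB F.L) W) (LinearMap.adjoint (Qkc F n K hnK.le (c₀ F.L) (cB F.L) W))
              (((a₀ F.L * (c₀ F.L / cB F.L) * ((F.L : ℝ) ^ (K - n)) ^ 3 : ℝ) : ℂ)) y⟫_ℂ := by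
  refine hCo_of_divRecovery c₀ cB a₀ (fun L _ => ha₀ L) ?_ ?_
  · -- (B4★) ⟹ (ENG): `γE := 1∕max CE 1`, `κD := 1`, `κQ := CQ·cB∕(a₀c₀)∕max CE 1`, `θE := 1029`
    intro L hL
    obtain ⟨CE, CQ, eE, hCE, hCQ, heE, H⟩ := hE L hL
    have ha : 0 < a₀ L := ha₀ L
    have hc : 0 < c₀ L := (hc₀ L).out
    have hb : 0 < cB L := (hcB L).out
    have hM1 : 1 ≤ max CE 1 := le_max_right _ _
    have hM0 : 0 < max CE 1 := by linarith
    refine ⟨1 / max CE 1, 1, (CQ * (cB L / (a₀ L * c₀ L))) / max CE 1, 1029, eE, by positivity, zero_le_one, by positivity, by norm_num, heE, ?_⟩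
    intro F hF n K hnK e W he heE' hreg y
    have h := H F hF n K hnK e W he heE' hreg y
    have hP := almostPos_DeltaEtaSlot_of_regPr (c₀ := c₀ F.L) he.le W hreg y
    subst hF
    set M : ℝ := max CE 1 with hM
    set P : ℝ := RCLike.re ⟪y, DeltaEtaSlot F n K (c₀ F.L) W y⟫_ℂ with hPdef
    set D : ℝ := ‖DstarL2 F n K (c₀ F.L) W y‖ ^ 2 with hDdef
    set Qn : ℝ := ‖Qkc F n K hnK.le (c₀ F.L) (cB F.L) W y‖ ^ 2 with hQdef
    set N : ℝ := ‖y‖ ^ 2 with hNdef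
    set l3 : ℝ := ((F.L : ℝ) ^ (K - n)) ^ 3 with hl3
    have hN : 0 ≤ N := sq_nonneg _
    have hD0 : 0 ≤ D := sq_nonneg _
    have hQ0 : 0 ≤ Qn := sq_nonneg _
    have hP' : 0 ≤ P + 1029 * e * N := by linarith
    -- `N ≤ M·((P + 1029eN) + D) + CQ·l3·Qn`
    have h1 : N ≤ M * ((P + 1029 * e * N) + D) + CQ * (l3 * Qn) := by
      have : CE * ((P + 1029 * e * N) + D) ≤ M * ((P + 1029 * e * N) + D) :=
        mul_le_mul_of_nonneg_right (le_max_left _ _) (by linarith)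
      linarith
    -- the penalty re-lettering: `CQ·l3·Qn = (CQ·cB∕(a₀c₀))·(a₀(c₀∕cB)·l3·Qn)`
    have hre : CQ * (l3 * Qn) = (CQ * (cB F.L / (a₀ F.L * c₀ F.L))) * (a₀ F.L * (c₀ F.L / cB F.L) * l3 * Qn) := by
      field_simp
    rw [hre] at h1
    -- divide by `M`
    have key : 1 / M * N ≤ P + 1 * D + CQ * (cB F.L / (a₀ F.L * c₀ F.L)) / M * (a₀ F.L * (c₀ F.L / cB F.L) * l3 * Qn) + 1029 * e * N := by
      have h3 : N / M ≤ (M * ((P + 1029 * e * N) + D) + CQ * (cB F.L / (a₀ F.L * c₀ F.L)) * (a₀ F.L * (c₀ F.L / cB F.L) * l3 * Qn)) / M :=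
        div_le_div_of_nonneg_right h1 hM0.le
      have h4 : (M * ((P + 1029 * e * N) + D) + CQ * (cB F.L / (a₀ F.L * c₀ F.L)) * (a₀ F.L * (c₀ F.L / cB F.L) * l3 * Qn)) / M
          = (P + 1029 * e * N) + D + CQ * (cB F.L / (a₀ F.L * c₀ F.L)) / M * (a₀ F.L * (c₀ F.L / cB F.L) * l3 * Qn) := by
        field_simp
      rw [h4] at h3
      have h5 : 1 / M * N = N / M := by ring
      rw [h5]
      linarith
    have e4 : a₀ F.L * (c₀ F.L / cB F.L) * l3 * Qn = a₀ F.L * (c₀ F.L / cB F.L) * ((F.L : ℝ) ^ (K - n)) ^ 3 * ‖Qkc F n K hnK.le (c₀ F.L) (cB F.L) W y‖ ^ 2 := by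
      rw [hl3, hQdef]
    rw [e4] at key
    exact key
  · -- (V3) ⟹ (REC): `C ↦ max C (C·cB∕(a₀c₀))`, `C′ := 1029·that`
    intro L hL δ hδ
    obtain ⟨C, eR, hC, heR, H⟩ := hDR L hL δ hδ
    refine ⟨max C (C * (cB L / (a₀ L * c₀ L))), 1029 * max C (C * (cB L / (a₀ L * c₀ L))), eR,
      le_max_of_le_left hC, by positivity, heR, ?_⟩
    intro F hF n K hnK e W he heR' hreg y
    have h := H F hF n K hnK e W he heR' hreg y
    have hP := almostPos_DeltaEtaSlot_of_regPr (c₀ := c₀ F.L) he.le W hreg y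
    subst hF
    have ha : 0 < a₀ F.L := ha₀ F.L
    have hc : 0 < c₀ F.L := (hc₀ F.L).out
    have hb : 0 < cB F.L := (hcB F.L).out
    set C₁ : ℝ := max C (C * (cB F.L / (a₀ F.L * c₀ F.L))) with hC₁
    set P : ℝ := RCLike.re ⟪y, DeltaEtaSlot F n K (c₀ F.L) W y⟫_ℂ with hPdef
    set Rr : ℝ := ‖RcombL2 F n K (c₀ F.L) W (DstarL2 F n K (c₀ F.L) W y)‖ ^ 2 with hRdef
    set Qn : ℝ := ‖Qkc F n K hnK.le (c₀ F.L) (cB F.L) W y‖ ^ 2 with hQdef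
    set N : ℝ := ‖y‖ ^ 2 with hNdef
    set l3 : ℝ := ((F.L : ℝ) ^ (K - n)) ^ 3 with hl3
    have hN : 0 ≤ N := sq_nonneg _
    have hR0 : 0 ≤ Rr := sq_nonneg _
    have hQ0 : 0 ≤ Qn := sq_nonneg _
    have hl30 : 0 ≤ l3 := by rw [hl3]; positivity
    have hP' : 0 ≤ P + 1029 * e * N := by linarith
    have hCle : C ≤ C₁ := le_max_left _ _
    have hC'le : C * (cB F.L / (a₀ F.L * c₀ F.L)) ≤ C₁ := le_max_right _ _
    -- re-letter the penalty and enlarge the constants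
    have hre : C * (l3 * Qn) = (C * (cB F.L / (a₀ F.L * c₀ F.L))) * (a₀ F.L * (c₀ F.L / cB F.L) * l3 * Qn) := by
      field_simp
    have hA0 : 0 ≤ a₀ F.L * (c₀ F.L / cB F.L) * l3 * Qn := by positivity
    have h1 : C * (Rr + l3 * Qn + (P + 1029 * e * N)) + δ * N
        ≤ C₁ * (Rr + a₀ F.L * (c₀ F.L / cB F.L) * l3 * Qn + P) + (1029 * C₁ * e + δ) * N := by
      have e1 : C * (Rr + l3 * Qn + (P + 1029 * e * N)) = C * Rr + C * (l3 * Qn) + C * (P + 1029 * e * N) := by ring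
      rw [e1, hre]
      have t1 : C * Rr ≤ C₁ * Rr := mul_le_mul_of_nonneg_right hCle hR0
      have t2 : (C * (cB F.L / (a₀ F.L * c₀ F.L))) * (a₀ F.L * (c₀ F.L / cB F.L) * l3 * Qn) ≤ C₁ * (a₀ F.L * (c₀ F.L / cB F.L) * l3 * Qn) :=
        mul_le_mul_of_nonneg_right hC'le hA0
      have t3 : C * (P + 1029 * e * N) ≤ C₁ * (P + 1029 * e * N) := mul_le_mul_of_nonneg_right hCle hP'
      nlinarith
    exact h.trans h1

end Skeleton


end Summit.QuantumFields.YangMills.Theorems.Prop7HcoOfDivRecovery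

end
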